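import Summits.NavierStokesRegularity.NavierStokesRegularity.Theorems.ScenarioCensusLargeOrderRigidityVocab

/-!
# Scenario census, rows F13m / F13mL / F13dL — profile rigidity at diverging symmetry order:
# part 2/6: S2ᴰ — (Z) `PeriodicL3Zero` (PROVED), the decomposition into
# (P) `WeakLimitEquivariance` and (V) `FarOrbitVanishing` (statements), the trichotomy tools

Port of the ideator's tree-ready kit (ns-idea-9 g6, LINE 14 «dihedral_noswirl» REV 7 025308a3fa185027; kit file 1
`pub/ideators/ns-idea-9/lines/dihedral_noswirl/landing/ScenarioCensusLargeOrderRigidity.lean`, sha16 9e20ac97d4307bb6, 1417 l., its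
declarations identical in REV 6/7; ref g7 PRE-CHECK ✓ §12.34, critic idea-crit-8 V56/V57/V58 PASS) by typer seat ns-census-typer-2 g8
(lead g8 GO 2026-08-28T18:02Z; census FROZEN v1.62 — sub-row F13dL flips to TREE on port ACCEPT + ref CHECK), split for the
400-line rule into SIX modules `ScenarioCensusLargeOrderRigidity{Vocab, Statements, P, Geom, V}` → `ScenarioCensusLargeOrderRigidity`
(this last name is the kit's, so that kit file 2 `ScenarioCensusRowF13dLargeL3.lean` — ported by typer-1 g5 — imports it unchanged).
Declarations VERBATIM in the kit's namespace `…Theorems.ScenarioCensus.LargeOrderRigidity`; the only edits: the kit's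
`local notation "ℝ³"` is replaced by the abbreviation `R3` (typer lint: no notation in ported files) and one-line docstrings are
added to undocumented auxiliaries.

No census ROW value and no summit statement is proved in this file; `Row_F13mLarge` stays OPEN.
-/

noncomputable section

set_option linter.dupNamespace false
set_option linter.unusedVariables false

open Set Function Filter Topology MeasureTheory Metric TopologicalSpace
open scoped NNReal ENNReal RealInnerProductSpace

namespace Summit.NavierStokesRegularity.NavierStokesRegularity.Theorems.ScenarioCensus.LargeOrderRigidity

open Literature.Analysis Literature.Analysis.FluidPDE
open Summit.NavierStokesRegularity.NavierStokesRegularity.Theorems.ScenarioCensus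

/-! ## S2ᴰ — profile rigidity with mirror (stub 1 of 2) -/

/-- **First lemma of S2ᴰ, typed (sub-lemma (Z) of the plan):** a field in `L³(R3)` that is a.e. invariant
under a non-zero translation vanishes a.e.  Stated as a `Prop`; PROVED right below (`periodicL3Zero_holds`). -/
def PeriodicL3Zero : Prop :=
  ∀ (f : R3 → R3) (τ : R3), τ ≠ 0 → MemLp f 3 volume → ((fun x => f (x + τ)) =ᵐ[volume] f) →
    f =ᵐ[volume] (0 : R3 → R3)

/-- translated balls carry the same `∫⁻ G` when `G` is a.e. invariant under the translation. -/
theorem setLIntegral_ball_neg_eq_of_ae_invariant (G : R3 → ℝ≥0∞) (c : R3) (R : ℝ)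
    (hc : ∀ᵐ x ∂(volume : Measure R3), G (x + c) = G x) :
    ∫⁻ x in ball (-c) R, G x = ∫⁻ x in ball (0 : R3) R, G x := by
  have hmem : ∀ x : R3, x ∈ ball (-c) R ↔ x + c ∈ ball (0 : R3) R := by
    intro x; simp [Metric.mem_ball, dist_eq_norm]
  calc ∫⁻ x in ball (-c) R, G x = ∫⁻ x in ball (-c) R, G (x + c) :=
        lintegral_congr_ae ((ae_restrict_of_ae hc).mono fun x hx => hx.symm)
    _ = ∫⁻ x, (ball (-c) R).indicator (fun x => G (x + c)) x :=
        (lintegral_indicator measurableSet_ball _).symm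
    _ = ∫⁻ x, (ball (0 : R3) R).indicator G (x + c) := by
        refine lintegral_congr fun x => ?_
        by_cases hx : x ∈ ball (-c) R
        · have hx' : x + c ∈ ball (0 : R3) R := (hmem x).1 hx
          rw [indicator_of_mem hx, indicator_of_mem hx']
        · have hx' : x + c ∉ ball (0 : R3) R := fun h => hx ((hmem x).2 h)
          rw [indicator_of_notMem hx, indicator_of_notMem hx']
    _ = ∫⁻ x, (ball (0 : R3) R).indicator G x :=
        lintegral_add_right_eq_self (μ := (volume : Measure R3)) _ c
    _ = ∫⁻ x in ball (0 : R3) R, G x := lintegral_indicator measurableSet_ball _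

/-- **(Z) PROVED:** an `L³(R3)` field a.e. invariant under a non-zero translation vanishes a.e.
(`N` pairwise disjoint translates of a ball carry equal mass `≤ ‖f‖₃³`, for every `N`). -/
theorem periodicL3Zero_holds : PeriodicL3Zero := by
  intro f τ hτ hf hper
  set G : R3 → ℝ≥0∞ := fun x => ‖f x‖ₑ ^ (3 : ℝ) with hGdef
  have hGm : AEMeasurable G volume := hf.aestronglyMeasurable.enorm.pow_const _
  have hGfin : ∫⁻ x, G x ∂volume < ∞ := by
    have h := lintegral_rpow_enorm_lt_top_of_eLpNorm_lt_top (p := (3 : ℝ≥0∞)) (by norm_num)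
      (by norm_num) hf.eLpNorm_lt_top
    have h3 : (3 : ℝ≥0∞).toReal = 3 := by norm_num
    simpa [G, h3] using h
  -- a.e. invariance of `G` under `x ↦ x + n • τ`, `n : ℕ`
  have hG1 : ∀ᵐ x ∂(volume : Measure R3), G (x + τ) = G x := by
    filter_upwards [hper] with x hx
    simp [G, hx]
  have hq : Measure.QuasiMeasurePreserving (fun x : R3 => x + τ) volume volume :=
    (measurePreserving_add_right volume τ).quasiMeasurePreserving
  have hGn : ∀ n : ℕ, ∀ᵐ x ∂(volume : Measure R3), G (x + (n : ℝ) • τ) = G x := by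
    intro n
    induction n with
    | zero => exact Eventually.of_forall fun x => by simp
    | succ n ih =>
      have h2 : ∀ᵐ x ∂(volume : Measure R3), G ((x + τ) + (n : ℝ) • τ) = G (x + τ) :=
        hq.tendsto_ae.eventually ih
      filter_upwards [h2, hG1] with x h2x h1x
      have hx' : x + (((n + 1 : ℕ) : ℝ)) • τ = (x + τ) + (n : ℝ) • τ := by
        push_cast
        rw [add_smul, one_smul]; abel
      rw [hx', h2x, h1x]
  -- the mass of every ball `ball 0 R` vanishes
  have hball : ∀ R : ℝ, 0 < R → ∫⁻ x in ball (0 : R3) R, G x = 0 := by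
    intro R hR
    set A := ∫⁻ x in ball (0 : R3) R, G x with hA
    have hτpos : 0 < ‖τ‖ := norm_pos_iff.2 hτ
    obtain ⟨K, hK⟩ := exists_nat_gt (2 * R / ‖τ‖)
    have hK' : 2 * R < (K : ℝ) * ‖τ‖ := by
      rwa [div_lt_iff₀ hτpos] at hK
    have hKpos : 0 < (K : ℝ) * ‖τ‖ := by linarith
    -- centres of the translated balls
    set c : ℕ → R3 := fun n => -((((n * K : ℕ)) : ℝ) • τ) with hc
    have hterm : ∀ n : ℕ, ∫⁻ x in ball (c n) R, G x = A := fun n =>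
      setLIntegral_ball_neg_eq_of_ae_invariant G ((((n * K : ℕ)) : ℝ) • τ) R (hGn (n * K))
    have hdisj : ∀ N : ℕ,
        Set.PairwiseDisjoint (↑(Finset.range N) : Set ℕ) fun n => ball (c n) R := by
      intro N n _ n' _ hne
      refine Metric.ball_disjoint_ball ?_
      have hd : dist (c n) (c n') = |(n : ℝ) - n'| * ((K : ℝ) * ‖τ‖) := by
        have : c n - c n' = ((((n' * K : ℕ)) : ℝ) - (((n * K : ℕ)) : ℝ)) • τ := by
          simp only [c]; rw [sub_smul]; abel
        rw [dist_eq_norm, this, norm_smul, Real.norm_eq_abs]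
        push_cast
        rw [show (n' : ℝ) * K - n * K = (n' - n) * K by ring, abs_mul, abs_sub_comm, Nat.abs_cast]
        ring
      have hne' : (1 : ℝ) ≤ |(n : ℝ) - n'| := by
        rcases lt_or_gt_of_ne hne with h | h
        · have h' : (n : ℝ) + 1 ≤ n' := by exact_mod_cast h
          rw [abs_sub_comm, abs_of_nonneg (by linarith)]; linarith
        · have h' : (n' : ℝ) + 1 ≤ n := by exact_mod_cast h
          rw [abs_of_nonneg (by linarith)]; linarith
      calc R + R = 2 * R := by ring
        _ ≤ (K : ℝ) * ‖τ‖ := hK'.le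
        _ = 1 * ((K : ℝ) * ‖τ‖) := (one_mul _).symm
        _ ≤ |(n : ℝ) - n'| * ((K : ℝ) * ‖τ‖) := mul_le_mul_of_nonneg_right hne' hKpos.le
        _ = dist (c n) (c n') := hd.symm
    have hsum : ∀ N : ℕ, (N : ℝ≥0∞) * A ≤ ∫⁻ x, G x := by
      intro N
      calc (N : ℝ≥0∞) * A = ∑ n ∈ Finset.range N, A := by
            rw [Finset.sum_const, Finset.card_range, nsmul_eq_mul]
        _ = ∑ n ∈ Finset.range N, ∫⁻ x in ball (c n) R, G x :=
            Finset.sum_congr rfl fun n _ => (hterm n).symm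
        _ = ∫⁻ x in ⋃ n ∈ Finset.range N, ball (c n) R, G x :=
            (lintegral_biUnion_finset (hdisj N) (fun _ _ => measurableSet_ball) G).symm
        _ ≤ ∫⁻ x, G x := setLIntegral_le_lintegral _ _
    by_contra hA0
    obtain ⟨N, hN⟩ := ENNReal.exists_nat_mul_gt hA0 hGfin.ne
    exact absurd (hsum N) (not_le.2 hN)
  -- conclusion: `G = 0` a.e., hence `f = 0` a.e.
  have hae : ∀ k : ℕ, ∀ᵐ x ∂(volume : Measure R3), x ∈ ball (0 : R3) ((k : ℝ) + 1) → G x = 0 := by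
    intro k
    have h0 := hball ((k : ℝ) + 1) (by positivity)
    have h1 : G =ᵐ[volume.restrict (ball (0 : R3) ((k : ℝ) + 1))] 0 :=
      (lintegral_eq_zero_iff' hGm.restrict).1 h0
    have h2 : ∀ᵐ x ∂(volume.restrict (ball (0 : R3) ((k : ℝ) + 1))), G x = 0 :=
      h1.mono fun x hx => by simpa using hx
    exact (ae_restrict_iff' measurableSet_ball).1 h2
  have hall := ae_all_iff.2 hae
  filter_upwards [hall] with x hx
  have hxk : x ∈ ball (0 : R3) ((⌈‖x‖⌉₊ : ℝ) + 1) := by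
    rw [mem_ball_zero_iff]; exact (Nat.le_ceil ‖x‖).trans_lt (lt_add_one _)
  have hGx : G x = 0 := hx _ hxk
  have h0 : ‖f x‖ₑ = 0 := by
    have h := hGx
    simp only [G] at h
    rcases ENNReal.rpow_eq_zero_iff.1 h with ⟨h0, _⟩ | ⟨_, hneg⟩
    · exact h0
    · norm_num at hneg
  simpa using h0


/-- **(D)** if `m_j → ∞` then every angle `θ` is a limit of lattice angles `2π k_j / m_j`, `k_j ∈ ℤ`. -/
theorem exists_int_seq_tendsto_angle {m : ℕ → ℕ} (hm : Tendsto m atTop atTop) (θ : ℝ) :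
    ∃ k : ℕ → ℤ, Tendsto (fun j => 2 * Real.pi * (k j : ℝ) / (m j : ℝ)) atTop (𝓝 θ) := by
  refine ⟨fun j => ⌊θ * (m j : ℝ) / (2 * Real.pi)⌋, ?_⟩
  have hπ : 0 < 2 * Real.pi := by positivity
  have hm' : Tendsto (fun j => (m j : ℝ)) atTop atTop := tendsto_natCast_atTop_atTop.comp hm
  have hinv : Tendsto (fun j => 2 * Real.pi / (m j : ℝ)) atTop (𝓝 0) :=
    tendsto_const_nhds.div_atTop hm'
  have hlow : Tendsto (fun j => θ - 2 * Real.pi / (m j : ℝ)) atTop (𝓝 θ) := by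
    simpa using tendsto_const_nhds.sub hinv
  refine tendsto_of_tendsto_of_tendsto_of_le_of_le' hlow tendsto_const_nhds ?_ ?_
  · filter_upwards [hm'.eventually_gt_atTop 0] with j hj
    have h1 : θ * (m j : ℝ) / (2 * Real.pi) - 1 < (⌊θ * (m j : ℝ) / (2 * Real.pi)⌋ : ℝ) :=
      Int.sub_one_lt_floor _
    -- multiply by `2π / m_j > 0`
    have h1' := (mul_lt_mul_of_pos_right h1 (div_pos hπ hj))
    have e1 : (θ * (m j : ℝ) / (2 * Real.pi) - 1) * (2 * Real.pi / (m j : ℝ))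
        = θ - 2 * Real.pi / (m j : ℝ) := by
      field_simp
    have e2 : (⌊θ * (m j : ℝ) / (2 * Real.pi)⌋ : ℝ) * (2 * Real.pi / (m j : ℝ))
        = 2 * Real.pi * (⌊θ * (m j : ℝ) / (2 * Real.pi)⌋ : ℝ) / (m j : ℝ) := by
      ring
    rw [e1, e2] at h1'
    exact h1'.le
  · filter_upwards [hm'.eventually_gt_atTop 0] with j hj
    have h2 : (⌊θ * (m j : ℝ) / (2 * Real.pi)⌋ : ℝ) ≤ θ * (m j : ℝ) / (2 * Real.pi) := Int.floor_le _
    have h2' := mul_le_mul_of_nonneg_right h2 (div_pos hπ hj).le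
    have e1 : θ * (m j : ℝ) / (2 * Real.pi) * (2 * Real.pi / (m j : ℝ)) = θ := by
      field_simp
    have e2 : (⌊θ * (m j : ℝ) / (2 * Real.pi)⌋ : ℝ) * (2 * Real.pi / (m j : ℝ))
        = 2 * Real.pi * (⌊θ * (m j : ℝ) / (2 * Real.pi)⌋ : ℝ) / (m j : ℝ) := by
      ring
    rw [e1, e2] at h2'
    exact h2'

/-! ## S2 decomposed (rev 2): two analytic sub-stubs (P), (V) + a PROVED trichotomy

S2 («profile rigidity at diverging cyclic order») is reduced, kernel-checked, to two named classical
lemmas — (P) `WeakLimitEquivariance` and (V) `FarOrbitVanishing` — plus the PROVED pieces (Z)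
`periodicL3Zero_holds`, (D) `exists_nat_seq_tendsto_angle`, (E) `IsCyclicEquivariantAbout.iterate`,
(S) `exists_power_window`, the case lemmas `aeAxisymmetric_of_tendsto_centres` (case (i)),
`ae_zero_of_norm_centres_tendsto` (cases (ii)/(iii)) and the PROVED composition `profileRigidity_of`;
S2ᴰ adds the mirror in case (i) (`aeMirrorSymmetric_of_tendsto_centres`) — composition `profileRigidityD_of`.
-/

/-- the weak-convergence clause of S2 (against smooth compactly supported test fields). -/
def WeakTo (a : ℕ → R3 → R3) (f : R3 → R3) : Prop :=
  ∀ φ : R3 → R3, FunctionSpaces.IsTestFunctionOn (⊤ : Opens R3) φ →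
    Tendsto (fun j => ∫ x, ⟪a j x, φ x⟫) atTop (𝓝 (∫ x, ⟪f x, φ x⟫))

/-- Auxiliary step of LINE 14 «dihedral_noswirl» (`WeakTo.comp`), ported verbatim. -/
theorem WeakTo.comp {a : ℕ → R3 → R3} {f : R3 → R3} (h : WeakTo a f) {σ : ℕ → ℕ} (hσ : StrictMono σ) :
    WeakTo (a ∘ σ) f :=
  fun φ hφ => (h φ hφ).comp hσ.tendsto_atTop

/-! ### the two analytic sub-lemmas of S2 — statements (both PROVED below, rev 3) -/

/-- **(P) weak limits inherit equivariance along converging affine isometries.**  `a_j ⇀ f` weakly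
(against test fields), `‖a_j‖₃ ≤ M`, `a_j (b_j + L_j y) = L_j (a_j y)` for all `y`, with `b_j → b` and
linear isometries `L_j → L` pointwise ⇒ `f (b + L y) = L (f y)` for a.e. `y`.  (Change of variables in the
pairing + `‖φ ∘ A_j⁻¹ − φ ∘ A⁻¹‖_{3/2} → 0` for test fields + Hölder; test fields separate `L³`.) -/
def WeakLimitEquivariance : Prop :=
  ∀ (M : ℝ≥0) (a : ℕ → R3 → R3) (f : R3 → R3) (b : ℕ → R3) (L : ℕ → R3 ≃ₗᵢ[ℝ] R3) (b' : R3)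
    (L' : R3 ≃ₗᵢ[ℝ] R3),
    (∀ j, MemLp (a j) 3 volume ∧ eLpNorm (a j) 3 volume ≤ (M : ℝ≥0∞)) → MemLp f 3 volume →
    WeakTo a f → Tendsto b atTop (𝓝 b') → (∀ y, Tendsto (fun j => L j y) atTop (𝓝 (L' y))) →
    (∀ j y, a j (b j + L j y) = L j (a j y)) →
    (fun y => f (b' + L' y)) =ᵐ[volume] fun y => L' (f y)

/-- **(V) far orbits ⇒ vanishing weak limit (the BUDGET is used here).**  `C_{m_j}`-equivariant `a_j` about
HORIZONTAL centres `c_j` (`c_j 2 = 0`, as produced by S1 — rev 3 adds this binder: without it a vertical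
translate of the axis with a fixed axisymmetric field refutes the statement) with `‖a_j‖₃ ≤ M`, `m_j → ∞`, and
orbit spacing `‖c_j‖ sin(π/m_j) → ∞` have `a_j ⇀ 0`: the `m_j` rotated copies of a test field have eventually
pairwise disjoint supports and pair identically with `a_j`, so `|⟨a_j, φ⟩| ≤ M m_j^{-1/3} ‖φ‖_{3/2}`. -/
def FarOrbitVanishing : Prop :=
  ∀ (M : ℝ≥0) (m : ℕ → ℕ) (c : ℕ → R3) (a : ℕ → R3 → R3) (f : R3 → R3),
    Tendsto m atTop atTop → (∀ j, c j 2 = 0) →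
    (∀ j, MemLp (a j) 3 volume ∧ eLpNorm (a j) 3 volume ≤ (M : ℝ≥0∞)) →
    (∀ j, IsCyclicEquivariantAbout (m j) (c j) (a j)) → MemLp f 3 volume → WeakTo a f →
    Tendsto (fun j => ‖c j‖ * Real.sin (Real.pi / m j)) atTop atTop →
    f =ᵐ[volume] (0 : R3 → R3)

end Summit.NavierStokesRegularity.NavierStokesRegularity.Theorems.ScenarioCensus.LargeOrderRigidity

end
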